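import Literature.Computability.AlgebraicComplexity.BorderRankMatMulLandsbergMichalekAllFields
import Literature.Computability.AlgebraicComplexity.LickteigBorderSubstitution
import HarnessLib

/-!
# Kernel border-rank FLOORS of the small formats over EVERY field (census cells, derived)

Topic `Summits/MatrixMultiplication/OmegaCensus/SmallFormats` (cell pub-omega, family (a), border-rank
column of the small-format census; filed by lit g40 under the lead's one-off assignment L32-34).
Framing: lottery ticket; floor = certified bounds/negative ranges.

`BorderRankLowerCells.lean` (same directory) records the one-line kernel floors of `R̲(⟨k,m,n⟩)`,
`2 ≤ k ≤ m ≤ n ≤ 5`, over fields of CHARACTERISTIC `0`, built from the `p = 1` Koszul flattening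
`3nm ≤ 2·R̲(⟨n,m,n⟩)` and Landsberg–Ottaviani's `2n² − n` (both `[CharZero K]` in the tree at the time)
plus Lickteig's every-field increment. Since then the Literature side proved, over EVERY field,

* `LandsbergOttaviani2015_thm_1_1_allFields (K) (n l) : (2n−1)·l ≤ R̲(⟨n,l,n⟩) ∧ … R̲(⟨n,n,l⟩) ∧ … R̲(⟨l,n,n⟩)`
  (LO15 Thm 1.1 in the printed-proof case `n = m`, `BorderRankMatMulLandsbergOttavianiAllFields.lean`),
* `LandsbergMichalek2018_borderRank_matMulTensor_allFields (K : Type) (n) : 2n² ≤ R̲(⟨n,n,n⟩) + ⌈log₂ n⌉ + 1`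
  (`BorderRankMatMulLandsbergMichalekAllFields.lean`),

so this file SUPERSEDES BY NAME (it does not edit) the characteristic-`0` cells with every-field ones, and
five floors RISE in every characteristic (LO15 `l(2n−1)` beats the `p = 1` value `3nl/2`):

| format | floor here (every field) | was (`BorderRankLowerCells`, char 0) | by |
|---|---|---|---|
| 22n | 3n (`border_22n`) | 3n | LO15 `n = m = 2` |
| 223 / 224 / 225 | 9 / 12 / 15 | same, char 0 | LO15 |
| 233 | 10 | same, char 0 | flattening 9 + Lickteig |
| 234 / 235 | 13 / 16 | same, char 0 | 224 / 225 + Lickteig |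
| 244 / 245 / 255 / 355 | 17 / 21 / 26 / 27 | same, ALREADY every field there | (not restated) |
| 333 | 15 every field (`LandsbergOttaviani2015_algBorderRank_matMulTensor_allFields K 3`); 17 char 0 | 15 / 17 | (not restated) |
| **334** | **20** | 18 | LO15 `⟨3,3,4⟩` |
| **335** | **25** | 23 | LO15 `⟨3,3,5⟩` |
| **344** | **21** | 19 | LO15 `⟨4,4,3⟩` |
| **345** | **26** | 24 | 335 + Lickteig |
| **445** | **35** | 30 | LO15 `⟨4,4,5⟩` |
| **455** | **36** | 31 | LO15 `⟨5,5,4⟩` |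
| 444 | 29 (`K : Type`) | 28 (29 over `ℂ`, LM18 fact, since proved) | LM18 every field |
| 555 | 46 (`K : Type`) | 45 | LM18 every field |

Each cell is stated for the sorted format together with its two cyclic rotations (transposes are one
`algBorderRank_matMulTensor_transpose` away). Kernel ceilings are unchanged (see `BorderRankLowerCells`).

## References

* [LandsbergOttaviani2015] J. M. Landsberg, G. Ottaviani, Theory Comput. 11 (2015) 285–298, Thm 1.1 —
  every-field form in tree (`LandsbergOttaviani2015_thm_1_1_allFields`).
* [LandsbergMichalek2018] J. M. Landsberg, M. Michałek, IMRN 2018 (15) 4722–4733, Thm. 1.1 — every-field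
  form in tree (`LandsbergMichalek2018_borderRank_matMulTensor_allFields`).
* [Lickteig1984] T. Lickteig, Inform. Process. Lett. 18 (1984) 173–178 — the increment, in tree
  (`algBorderRank_matMulTensor_succ_le`, every field).
-/

noncomputable section

namespace Summit.MatrixMultiplication.OmegaCensus.BorderRankLowerCellsAllFields

open Literature.Computability.AlgebraicComplexity

universe u

variable (K : Type u) [Field K]

/-- Rotations of a floor: `r ≤ R̲(⟨k,m,n⟩)` gives the same for `⟨m,n,k⟩` and `⟨n,k,m⟩`
(`algBorderRank_matMulTensor_rotate`). [cite: Lickteig1984, main result (rotation invariance, tree)] -/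
theorem rot3 {k m n r : ℕ} (h : r ≤ algBorderRank (matMulTensor K k m n)) :
    r ≤ algBorderRank (matMulTensor K k m n) ∧ r ≤ algBorderRank (matMulTensor K m n k) ∧
      r ≤ algBorderRank (matMulTensor K n k m) := by
  refine ⟨h, ?_, ?_⟩
  · rwa [algBorderRank_matMulTensor_rotate K k m n] at h
  · rwa [← algBorderRank_matMulTensor_rotate K n k m] at h

/-- **`3n ≤ R̲(⟨2,2,n⟩)`, `R̲(⟨2,n,2⟩)`, `R̲(⟨n,2,2⟩)` over every field** (LO15 Thm 1.1 at `n = m = 2`;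
supersedes the char-0 `BorderRankLowerCells.three_mul_le_algBorderRank_matMulTensor_22n`).
[cite: LandsbergOttaviani2015, Thm 1.1] -/
theorem border_22n (n : ℕ) :
    3 * n ≤ algBorderRank (matMulTensor K 2 2 n) ∧ 3 * n ≤ algBorderRank (matMulTensor K 2 n 2) ∧
      3 * n ≤ algBorderRank (matMulTensor K n 2 2) := by
  obtain ⟨h1, h2, h3⟩ := LandsbergOttaviani2015_thm_1_1_allFields K 2 n
  norm_num at h1 h2 h3
  exact ⟨h2, h1, h3⟩

/-- `9 ≤ R̲` for `⟨2,2,3⟩` and its rotations, every field (supersedes the char-0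
`nine_le_algBorderRank_matMulTensor_223`). [cite: LandsbergOttaviani2015, Thm 1.1] -/
theorem border_223 :
    9 ≤ algBorderRank (matMulTensor K 2 2 3) ∧ 9 ≤ algBorderRank (matMulTensor K 2 3 2) ∧
      9 ≤ algBorderRank (matMulTensor K 3 2 2) := by
  simpa using border_22n K 3

/-- `12 ≤ R̲` for `⟨2,2,4⟩` and its rotations, every field (supersedes the char-0
`BorderRankLowerCells.twelve_le_algBorderRank_matMulTensor_224`). [cite: LandsbergOttaviani2015, Thm 1.1] -/
theorem border_224 :
    12 ≤ algBorderRank (matMulTensor K 2 2 4) ∧ 12 ≤ algBorderRank (matMulTensor K 2 4 2) ∧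
      12 ≤ algBorderRank (matMulTensor K 4 2 2) := by
  simpa using border_22n K 4

/-- `15 ≤ R̲` for `⟨2,2,5⟩` and its rotations, every field (supersedes the char-0
`BorderRankLowerCells.fifteen_le_algBorderRank_matMulTensor_225`). [cite: LandsbergOttaviani2015, Thm 1.1] -/
theorem border_225 :
    15 ≤ algBorderRank (matMulTensor K 2 2 5) ∧ 15 ≤ algBorderRank (matMulTensor K 2 5 2) ∧
      15 ≤ algBorderRank (matMulTensor K 5 2 2) := by
  simpa using border_22n K 5

/-- `10 ≤ R̲` for `⟨2,3,3⟩` and its rotations, every field: flattening `9 ≤ R̲(⟨1,3,3⟩)` + Lickteig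
(supersedes the char-0 `BorderRankLowerCells.ten_le_algBorderRank_matMulTensor_233`; the printed char-0
value is `14`, CHL 2023). [cite: Lickteig1984, main result] -/
theorem border_233 :
    10 ≤ algBorderRank (matMulTensor K 2 3 3) ∧ 10 ≤ algBorderRank (matMulTensor K 3 3 2) ∧
      10 ≤ algBorderRank (matMulTensor K 3 2 3) := by
  have h0 : 3 * 3 ≤ algBorderRank (matMulTensor K 1 3 3) :=
    mul_le_algBorderRank_matMulTensor_right K 1 3 3
  have h1 : algBorderRank (matMulTensor K 1 3 3) + 1 ≤ algBorderRank (matMulTensor K 2 3 3) :=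
    algBorderRank_matMulTensor_succ_le K 1 3 3 (by norm_num) (by norm_num)
  exact rot3 K (by omega)

/-- `13 ≤ R̲` for `⟨2,3,4⟩` and its rotations, every field: `12 ≤ R̲(⟨2,4,2⟩)` + Lickteig (supersedes the
char-0 `BorderRankLowerCells.thirteen_le_algBorderRank_matMulTensor_234`). [cite: Lickteig1984, main result] -/
theorem border_234 :
    13 ≤ algBorderRank (matMulTensor K 2 3 4) ∧ 13 ≤ algBorderRank (matMulTensor K 3 4 2) ∧
      13 ≤ algBorderRank (matMulTensor K 4 2 3) := by
  have h0 := (border_224 K).2.1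
  have h1 : algBorderRank (matMulTensor K 2 4 2) + 1 ≤ algBorderRank (matMulTensor K 3 4 2) :=
    algBorderRank_matMulTensor_succ_le K 2 4 2 (by norm_num) (by norm_num)
  have h : 13 ≤ algBorderRank (matMulTensor K 2 3 4) := by
    rw [algBorderRank_matMulTensor_rotate K 2 3 4]; omega
  exact rot3 K h

/-- `16 ≤ R̲` for `⟨2,3,5⟩` and its rotations, every field: `15 ≤ R̲(⟨2,5,2⟩)` + Lickteig (supersedes the
char-0 `BorderRankLowerCells.sixteen_le_algBorderRank_matMulTensor_235`). [cite: Lickteig1984, main result] -/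
theorem border_235 :
    16 ≤ algBorderRank (matMulTensor K 2 3 5) ∧ 16 ≤ algBorderRank (matMulTensor K 3 5 2) ∧
      16 ≤ algBorderRank (matMulTensor K 5 2 3) := by
  have h0 := (border_225 K).2.1
  have h1 : algBorderRank (matMulTensor K 2 5 2) + 1 ≤ algBorderRank (matMulTensor K 3 5 2) :=
    algBorderRank_matMulTensor_succ_le K 2 5 2 (by norm_num) (by norm_num)
  have h : 16 ≤ algBorderRank (matMulTensor K 2 3 5) := by
    rw [algBorderRank_matMulTensor_rotate K 2 3 5]; omega
  exact rot3 K h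

/-- **`20 ≤ R̲` for `⟨3,3,4⟩` and its rotations, every field** (was `18`, char 0:
`BorderRankLowerCells.eighteen_le_algBorderRank_matMulTensor_334`). [cite: LandsbergOttaviani2015, Thm 1.1] -/
theorem border_334 :
    20 ≤ algBorderRank (matMulTensor K 3 3 4) ∧ 20 ≤ algBorderRank (matMulTensor K 3 4 3) ∧
      20 ≤ algBorderRank (matMulTensor K 4 3 3) := by
  obtain ⟨h1, h2, h3⟩ := LandsbergOttaviani2015_thm_1_1_allFields K 3 4
  norm_num at h1 h2 h3
  exact ⟨h2, h1, h3⟩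

/-- **`25 ≤ R̲` for `⟨3,3,5⟩` and its rotations, every field** (was `23`, char 0:
`BorderRankLowerCells.twentythree_le_algBorderRank_matMulTensor_335`). [cite: LandsbergOttaviani2015, Thm 1.1] -/
theorem border_335 :
    25 ≤ algBorderRank (matMulTensor K 3 3 5) ∧ 25 ≤ algBorderRank (matMulTensor K 3 5 3) ∧
      25 ≤ algBorderRank (matMulTensor K 5 3 3) := by
  obtain ⟨h1, h2, h3⟩ := LandsbergOttaviani2015_thm_1_1_allFields K 3 5
  norm_num at h1 h2 h3
  exact ⟨h2, h1, h3⟩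

/-- **`21 ≤ R̲` for `⟨3,4,4⟩` and its rotations, every field** (was `19`, char 0:
`BorderRankLowerCells.nineteen_le_algBorderRank_matMulTensor_344`; LO15 at `⟨4,4,3⟩`).
[cite: LandsbergOttaviani2015, Thm 1.1] -/
theorem border_344 :
    21 ≤ algBorderRank (matMulTensor K 3 4 4) ∧ 21 ≤ algBorderRank (matMulTensor K 4 4 3) ∧
      21 ≤ algBorderRank (matMulTensor K 4 3 4) := by
  obtain ⟨h1, h2, h3⟩ := LandsbergOttaviani2015_thm_1_1_allFields K 4 3
  norm_num at h1 h2 h3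
  exact ⟨h3, h2, h1⟩

/-- **`26 ≤ R̲` for `⟨3,4,5⟩` and its rotations, every field** (was `24`, char 0:
`BorderRankLowerCells.twentyfour_le_algBorderRank_matMulTensor_345`): `25 ≤ R̲(⟨3,5,3⟩)` + Lickteig.
[cite: Lickteig1984, main result] [cite: LandsbergOttaviani2015, Thm 1.1] -/
theorem border_345 :
    26 ≤ algBorderRank (matMulTensor K 3 4 5) ∧ 26 ≤ algBorderRank (matMulTensor K 4 5 3) ∧
      26 ≤ algBorderRank (matMulTensor K 5 3 4) := by
  have h0 := (border_335 K).2.1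
  have h1 : algBorderRank (matMulTensor K 3 5 3) + 1 ≤ algBorderRank (matMulTensor K 4 5 3) :=
    algBorderRank_matMulTensor_succ_le K 3 5 3 (by norm_num) (by norm_num)
  have h : 26 ≤ algBorderRank (matMulTensor K 3 4 5) := by
    rw [algBorderRank_matMulTensor_rotate K 3 4 5]; omega
  exact rot3 K h

/-- **`35 ≤ R̲` for `⟨4,4,5⟩` and its rotations, every field** (was `30`, char 0:
`BorderRankLowerCells.thirty_le_algBorderRank_matMulTensor_445`). [cite: LandsbergOttaviani2015, Thm 1.1] -/
theorem border_445 :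
    35 ≤ algBorderRank (matMulTensor K 4 4 5) ∧ 35 ≤ algBorderRank (matMulTensor K 4 5 4) ∧
      35 ≤ algBorderRank (matMulTensor K 5 4 4) := by
  obtain ⟨h1, h2, h3⟩ := LandsbergOttaviani2015_thm_1_1_allFields K 4 5
  norm_num at h1 h2 h3
  exact ⟨h2, h1, h3⟩

/-- **`36 ≤ R̲` for `⟨4,5,5⟩` and its rotations, every field** (was `31`, char 0:
`BorderRankLowerCells.thirtyone_le_algBorderRank_matMulTensor_455`; LO15 at `⟨5,5,4⟩`).
[cite: LandsbergOttaviani2015, Thm 1.1] -/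
theorem border_455 :
    36 ≤ algBorderRank (matMulTensor K 4 5 5) ∧ 36 ≤ algBorderRank (matMulTensor K 5 5 4) ∧
      36 ≤ algBorderRank (matMulTensor K 5 4 5) := by
  obtain ⟨h1, h2, h3⟩ := LandsbergOttaviani2015_thm_1_1_allFields K 5 4
  norm_num at h1 h2 h3
  exact ⟨h3, h2, h1⟩

/-- **`29 ≤ R̲(⟨4,4,4⟩)` over every field `K : Type`** (was `28` every field / `29` char 0; LM18 every
field at `n = 4`, `⌈log₂ 4⌉ = 2`). [cite: LandsbergMichalek2018, Thm. 1.1] -/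
theorem border_444 (K : Type) [Field K] : 29 ≤ algBorderRank (matMulTensor K 4 4 4) := by
  have h := LandsbergMichalek2018_borderRank_matMulTensor_allFields K 4
  have hc : Nat.clog 2 4 = 2 := by decide
  rw [hc] at h
  omega

/-- **`46 ≤ R̲(⟨5,5,5⟩)` over every field `K : Type`** (was `45`; LM18 every field at `n = 5`,
`⌈log₂ 5⌉ = 3`). [cite: LandsbergMichalek2018, Thm. 1.1] -/
theorem border_555 (K : Type) [Field K] : 46 ≤ algBorderRank (matMulTensor K 5 5 5) := by
  have h := LandsbergMichalek2018_borderRank_matMulTensor_allFields K 5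
  have hc : Nat.clog 2 5 = 3 := by decide
  rw [hc] at h
  omega

end Summit.MatrixMultiplication.OmegaCensus.BorderRankLowerCellsAllFields

end
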